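import Literature.Analysis.Fourier.FejerKernelDerivativePair
import Literature.Analysis.Fourier.CompactFourierPoissonTwist
import Literature.NumberTheory.LFunctions.DirichletLOneTail
import Mathlib.Analysis.Normed.Group.Tannery
import HarnessLib

/-!
# Ramaré's approximate formula for `L(1,χ)` with the Fejér smoothing `F₄ = 1 − K` (odd characters)

Everything in this file is PROVED (theorems only; standard axioms).  Companion of
`RamareLOneEvenSmoothing.lean` (even characters, Vaaler's `F₃ = H`); here `F₄ = 1 − K`,
`K(x) = sinc²(πx)` (Ramaré, Acta Arith. 100 (2001), (1.10) and Proposition 2, odd case), whose dual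
kernel is the truncated quadratic `P(y) = (1 − min(y,1))² = ∫_y^1 2(1 − min(u,1)) du`
(hypothesis `hP`; `fejerDualP_eq`, `fejerDualP_eq_zero`, `hasDerivAt_fejerDualP`).

* `summable_fejerLSeries`, `tendsto_fejerLSeries` : `A(δ) = Σ_{n≥1} χ(n)K(δn)/n` converges
  absolutely for `δ > 0` and tends to `L(1,χ)` as `δ → 0⁺` (Abel summation + Tannery, as in the even
  file, with `|K'| ≤ 6/(1+x²)` from `FejerKernelDerivativePair`).
* `hasDerivAt_fejerLSeries` : `A'(δ) = Σ χ(n)K'(δn)`.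
* `tsum_char_mul_fejerDeriv_eq` : for ODD primitive `χ` (so that `n ↦ χ(n)K'(δn)` is even) twisted
  Poisson summation gives `Σ_{n≥1} χ(n)K'(δn) = (δq)⁻¹ τ(χ) Σ_{m≤q} χ̄(m) G(m/(δq))`,
  `G(u) = 2πi·u(1−|u|)₊`.
* `LFunction_one_eq_fejer_add_dual` — **Proposition 2 (odd χ)**: for `0 < δ < 1`,
  `L(1,χ) = Σ_{n≥1} χ(n)K(δn)/n − (iπτ(χ)/q) Σ_{m<q} χ̄(m+1) P((m+1)/(δq))`
  (Ramaré prints `+iπτ(χ)/q Σ_{1≤m≤δq} χ̄(m)(1 − m/(δq))²` with his sign conventions; only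
  `|iπτ(χ)/q| = π/√q` matters for Corollary 1).

What remains for Corollary 1 (odd): Lemma 17 (`Σ K(δn)/n = −log δ + 3/2 − log 2π + 2∫₀¹(1−t)
log(πδt/sin πδt)dt`, at least as an upper bound) and the final optimisation in `δ`; see the
successor notes of unit `littype-FP2-1`.

## References

* O. Ramaré, *Approximate formulae for L(1,χ)*, Acta Arith. 100 (2001) 245–266: Thm. 1 p. 246,
  (1.10) and Prop. 2 p. 247, Lemma 11 p. 256, (5.4) p. 260. [cite: Ramare2001LOneApproximateFormulae, Prop. 2]
-/

noncomputable section

open Real Filter Topology Set MeasureTheory intervalIntegral Finset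
open Literature.Analysis.Fourier

namespace Literature.NumberTheory.LFunctions.Ramare2001

variable {q : ℕ} [NeZero q] (χ : DirichletCharacter ℂ q)

/-! ## Auxiliary facts on `K(x) = sinc²(πx)` -/

section Aux

/-- Mean value bound: `|K(b) − K(a)| ≤ (b − a)·6/(1 + a²)` for `0 ≤ a ≤ b`.
[cite: Ramare2001LOneApproximateFormulae, (5.4) p. 260] -/
theorem abs_sinc_sq_sub_le {a b : ℝ} (ha : 0 ≤ a) (hab : a ≤ b) :
    |Real.sinc (π * b) ^ 2 - Real.sinc (π * a) ^ 2| ≤ 6 / (1 + a ^ 2) * (b - a) := by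
  have hbound : ∀ x ∈ Icc a b,
      ‖-(4 * π * ∫ t in (0:ℝ)..1, (1 - t) * t * Real.sin (2 * π * x * t))‖ ≤ 6 / (1 + a ^ 2) := by
    intro x hx
    rw [norm_neg, Real.norm_eq_abs]
    refine (abs_sinc_sq_deriv_le_div_one_add_sq x).trans ?_
    apply div_le_div_of_nonneg_left (by positivity) (by positivity)
    nlinarith [hx.1]
  have h := Convex.norm_image_sub_le_of_norm_hasDerivWithin_le
    (f := fun x : ℝ => Real.sinc (π * x) ^ 2)
    (fun x _ => (hasDerivAt_sinc_sq x).hasDerivWithinAt) hbound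
    (convex_Icc a b) (left_mem_Icc.2 hab) (right_mem_Icc.2 hab)
  rw [Real.norm_eq_abs, Real.norm_eq_abs, abs_of_nonneg (sub_nonneg.2 hab)] at h
  exact h

/-- For an even summable `f : ℤ → ℂ` with `f(0) = 0`: `Σ_ℤ f = 2 Σ_{n ≥ 1} f(n)`. [folklore] -/
private theorem tsum_int_eq_two_mul_tsum_nat {f : ℤ → ℂ} (hf : Summable f)
    (heven : ∀ n : ℤ, f (-n) = f n) (h0 : f 0 = 0) :
    ∑' n : ℤ, f n = 2 * ∑' n : ℕ, f ((n : ℤ) + 1) := by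
  obtain ⟨S, hS⟩ := hf.comp_injective Nat.cast_injective
  have hS' : HasSum (fun n : ℕ => f n) S := hS
  have h1 : HasSum (fun n : ℕ => f ((n : ℤ) + 1)) (S - f 0) := by
    have := (hasSum_nat_add_iff' 1).2 hS'
    simpa [Nat.cast_succ] using this
  have h2 : HasSum (fun n : ℕ => f (-((n : ℤ) + 1))) (S - f 0) :=
    h1.congr_fun fun n => by rw [heven]
  have h3 := HasSum.of_nat_of_neg_add_one hS' h2
  rw [h3.tsum_eq, h1.tsum_eq, h0]; ring

end Aux

/-! ## The smoothed series `A(δ) = Σ χ(n) K(δn)/n`: summability, limit `δ → 0⁺`, derivative -/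

section Smoothed

omit [NeZero q] in
/-- The Fejér-smoothed series converges absolutely for `δ > 0` (`K(δn)/n ≤ 1/(π²δ²n³)`).
[cite: Ramare2001LOneApproximateFormulae, Thm. 1 p. 246] -/
theorem summable_fejerLSeries {δ : ℝ} (hδ : 0 < δ) :
    Summable fun n : ℕ => χ ((n + 1 : ℕ) : ZMod q) *
      ((Real.sinc (π * (δ * (n + 1))) ^ 2 / (n + 1) : ℝ) : ℂ) := by
  have hreal : Summable fun n : ℕ => Real.sinc (π * (δ * (n + 1))) ^ 2 / (n + 1) := by
    refine Summable.of_nonneg_of_le (fun n => by positivity) (fun n => ?_)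
      ((summable_nat_add_iff 1 |>.2 (Real.summable_one_div_nat_pow.2 (by norm_num : 1 < 3))).mul_left
        (1 / (π ^ 2 * δ ^ 2)))
    have hx : π * (δ * (n + 1)) ≠ 0 := by positivity
    have hsinc : Real.sinc (π * (δ * (n + 1))) ^ 2 ≤ 1 / (π * (δ * (n + 1))) ^ 2 := by
      rw [Real.sinc_of_ne_zero hx, div_pow]
      gcongr
      nlinarith [Real.sin_sq_le_one (π * (δ * (n + 1)))]
    push_cast
    rw [div_le_iff₀ (by positivity : (0:ℝ) < n + 1)]
    calc Real.sinc (π * (δ * (n + 1))) ^ 2 ≤ 1 / (π * (δ * (n + 1))) ^ 2 := hsinc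
      _ = 1 / (π ^ 2 * δ ^ 2) * (1 / ((n : ℝ) + 1) ^ 3) * (n + 1) := by field_simp
  refine Summable.of_norm_bounded (g := fun n : ℕ => Real.sinc (π * (δ * (n + 1))) ^ 2 / (n + 1))
    hreal fun n => ?_
  rw [norm_mul, Complex.norm_real, Real.norm_eq_abs, abs_of_nonneg (by positivity)]
  exact mul_le_of_le_one_left (by positivity) (χ.norm_le_one _)

/-- **`A(δ) → L(1,χ)` as `δ → 0⁺`** for the Fejér smoothing (Abel summation against the tail
`Σ_{n>N} χ(n)/n = O(q/N)` and Tannery's theorem; the weights `K(δn)` lie in `[0,1]`, tend to `1`, and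
have increments `≪ δ/(1 + δ²n²)`). [cite: Ramare2001LOneApproximateFormulae, Thm. 1 p. 246 (proof, §IV)] -/
theorem tendsto_fejerLSeries (hχ1 : χ ≠ 1) :
    Tendsto (fun δ : ℝ => ∑' n : ℕ, χ ((n + 1 : ℕ) : ZMod q) *
      ((Real.sinc (π * (δ * (n + 1))) ^ 2 / (n + 1) : ℝ) : ℂ))
      (𝓝[>] 0) (𝓝 (χ.LFunction 1)) := by
  set C : ℝ := 6 with hC
  set L := χ.LFunction 1 with hL
  set a : ℕ → ℂ := fun n => χ ((n + 1 : ℕ) : ZMod q) / ((n : ℂ) + 1) with ha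
  set Rt : ℕ → ℂ := fun N => L - ∑ n ∈ Finset.range N, a n with hRt
  have hRt_le : ∀ N, ‖Rt N‖ ≤ 2 * q / ((N : ℝ) + 1) := by
    intro N
    rw [hRt, norm_sub_rev]
    exact DirichletAbel.norm_sum_div_sub_LFunction_one_le_level χ hχ1 N
  have hRt0 : Rt 0 = L := by simp [hRt]
  have hRa : ∀ n, a n = Rt n - Rt (n + 1) := by
    intro n; simp only [hRt, Finset.sum_range_succ]; ring
  set w : ℕ → ℝ → ℝ := fun n δ => Real.sinc (π * (δ * (n + 1))) ^ 2 with hw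
  have hterm : ∀ (n : ℕ) (δ : ℝ), χ ((n + 1 : ℕ) : ZMod q) *
      ((Real.sinc (π * (δ * (n + 1))) ^ 2 / (n + 1) : ℝ) : ℂ)
        = a n * (w n δ : ℂ) := by
    intro n δ; simp only [ha, hw]; push_cast; ring
  -- Abel summation (finite form)
  have habel : ∀ (δ : ℝ) (N : ℕ), ∑ n ∈ Finset.range N, a n * (w n δ : ℂ)
      = Rt 0 * (w 0 δ : ℂ) - Rt N * (w N δ : ℂ)
        + ∑ n ∈ Finset.range N, Rt (n + 1) * ((w (n + 1) δ : ℂ) - w n δ) := by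
    intro δ N
    induction N with
    | zero => simp
    | succ N ih => rw [Finset.sum_range_succ, Finset.sum_range_succ, ih, hRa]; ring
  -- the weights
  have hw_nonneg : ∀ (n : ℕ) {δ : ℝ}, 0 < δ → 0 ≤ w n δ := fun n δ _ => sq_nonneg _
  have hw_le_one : ∀ (n : ℕ) {δ : ℝ}, 0 < δ → w n δ ≤ 1 := fun n δ _ => by
    simp only [hw]
    rw [sq_le_one_iff_abs_le_one]; exact Real.abs_sinc_le_one _
  have hw_diff : ∀ (n : ℕ) {δ : ℝ}, 0 < δ → |w (n + 1) δ - w n δ| ≤ C / (2 * ((n:ℝ) + 1)) := by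
    intro n δ hδ
    have h1 := abs_sinc_sq_sub_le (a := δ * (n + 1)) (b := δ * (n + 1 + 1)) (by positivity)
      (by nlinarith)
    have h2 : 6 / (1 + (δ * (n + 1)) ^ 2) * (δ * (n + 1 + 1) - δ * (n + 1))
        ≤ C / (2 * ((n:ℝ) + 1)) := by
      rw [show δ * ((n:ℝ) + 1 + 1) - δ * (n + 1) = δ by ring, ← hC, div_mul_eq_mul_div,
        div_le_div_iff₀ (by positivity) (by positivity)]
      have hC0 : 0 ≤ C := by positivity
      nlinarith [mul_nonneg hC0 (sq_nonneg (δ * (n + 1) - 1))]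
    have h3 : w (n + 1) δ - w n δ = Real.sinc (π * (δ * (n + 1 + 1))) ^ 2 -
        Real.sinc (π * (δ * (n + 1))) ^ 2 := by
      simp only [hw]; push_cast; ring_nf
    rw [h3]
    exact h1.trans h2
  -- the dominating sequence
  have hq0 : (0:ℝ) ≤ q := Nat.cast_nonneg q
  set bound : ℕ → ℝ := fun n => q * C / ((n:ℝ) + 1) ^ 2 with hbound
  have hbound_sum : Summable bound := by
    have := ((summable_nat_add_iff 1).2 (Real.summable_one_div_nat_pow.2 one_lt_two)).mul_left
      (q * C)
    refine this.congr fun n => ?_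
    push_cast; ring
  have hD_le : ∀ (n : ℕ) {δ : ℝ}, 0 < δ → ‖Rt (n + 1) * ((w (n + 1) δ : ℂ) - w n δ)‖ ≤ bound n := by
    intro n δ hδ
    rw [norm_mul, ← Complex.ofReal_sub, Complex.norm_real, Real.norm_eq_abs]
    have h1 := hRt_le (n + 1)
    have h2 := hw_diff n hδ
    push_cast at h1
    have hC0 : 0 ≤ C := by positivity
    calc ‖Rt (n + 1)‖ * |w (n + 1) δ - w n δ|
        ≤ (2 * q / ((n:ℝ) + 1 + 1)) * (C / (2 * ((n:ℝ) + 1))) :=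
          mul_le_mul h1 h2 (abs_nonneg _) (by positivity)
      _ ≤ bound n := by
          simp only [hbound]
          rw [div_mul_div_comm, div_le_div_iff₀ (by positivity) (by positivity)]
          nlinarith [mul_nonneg (mul_nonneg hq0 hC0) (by positivity : (0:ℝ) ≤ ((n:ℝ) + 1) ^ 2)]
  have hD_summable : ∀ {δ : ℝ}, 0 < δ →
      Summable fun n => Rt (n + 1) * ((w (n + 1) δ : ℂ) - w n δ) :=
    fun hδ => Summable.of_norm_bounded (g := bound) hbound_sum fun n => hD_le n hδ
  -- the identity `A(δ) = L·w₀(δ) + Σ R_{n+1}(w_{n+1} − w_n)` for `0 < δ ≤ 1`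
  have hA_eq : ∀ {δ : ℝ}, 0 < δ → δ ≤ 1 →
      ∑' n : ℕ, χ ((n + 1 : ℕ) : ZMod q) *
        ((Real.sinc (π * (δ * (n + 1))) ^ 2 / (n + 1) : ℝ) : ℂ)
        = L * (w 0 δ : ℂ) + ∑' n, Rt (n + 1) * ((w (n + 1) δ : ℂ) - w n δ) := by
    intro δ hδ _
    have hs := summable_fejerLSeries χ hδ
    have h1 : Tendsto (fun N => ∑ n ∈ Finset.range N, a n * (w n δ : ℂ)) atTop
        (𝓝 (∑' n : ℕ, χ ((n + 1 : ℕ) : ZMod q) *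
          ((Real.sinc (π * (δ * (n + 1))) ^ 2 / (n + 1) : ℝ) : ℂ))) := by
      refine hs.hasSum.tendsto_sum_nat.congr fun N => Finset.sum_congr rfl fun n _ => hterm n δ
    have hRN : Tendsto (fun N => Rt N * (w N δ : ℂ)) atTop (𝓝 0) := by
      refine squeeze_zero_norm (a := fun N : ℕ => 2 * q / ((N : ℝ) + 1)) (fun N => ?_) ?_
      · rw [norm_mul, Complex.norm_real, Real.norm_eq_abs, abs_of_nonneg (hw_nonneg N hδ)]
        exact (mul_le_of_le_one_right (norm_nonneg _) (hw_le_one N hδ)).trans (hRt_le N)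
      · have := (tendsto_const_div_atTop_nhds_zero_nat (2 * (q:ℝ))).comp (tendsto_add_atTop_nat 1)
        refine this.congr fun N => ?_
        simp [Function.comp]
    have h2 : Tendsto (fun N => Rt 0 * (w 0 δ : ℂ) - Rt N * (w N δ : ℂ)
        + ∑ n ∈ Finset.range N, Rt (n + 1) * ((w (n + 1) δ : ℂ) - w n δ)) atTop
        (𝓝 (Rt 0 * (w 0 δ : ℂ) - 0 + ∑' n, Rt (n + 1) * ((w (n + 1) δ : ℂ) - w n δ))) :=
      (tendsto_const_nhds.sub hRN).add (hD_summable hδ).hasSum.tendsto_sum_nat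
    have h3 := tendsto_nhds_unique h1 (h2.congr fun N => (habel δ N).symm)
    rw [h3, hRt0, sub_zero]
  -- continuity of the weights at `δ = 0`
  have hw_tendsto : ∀ n, Tendsto (fun δ => (w n δ : ℂ)) (𝓝[>] 0) (𝓝 1) := by
    intro n
    have hc : Continuous fun δ : ℝ => (w n δ : ℂ) := by
      simp only [hw]
      exact Complex.continuous_ofReal.comp
        ((Real.continuous_sinc.comp (continuous_const.mul (continuous_id.mul continuous_const))).pow 2)
    have := hc.tendsto 0
    have h0 : (w n 0 : ℂ) = 1 := by
      simp [hw]
    rw [h0] at this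
    exact this.mono_left nhdsWithin_le_nhds
  have hmem : ∀ᶠ δ in 𝓝[>] (0:ℝ), 0 < δ ∧ δ ≤ 1 := by
    filter_upwards [Ioc_mem_nhdsGT zero_lt_one] with δ hδ using hδ
  have hD_tendsto : Tendsto (fun δ => ∑' n, Rt (n + 1) * ((w (n + 1) δ : ℂ) - w n δ))
      (𝓝[>] 0) (𝓝 0) := by
    have h := tendsto_tsum_of_dominated_convergence (𝓕 := 𝓝[>] (0:ℝ))
      (f := fun δ n => Rt (n + 1) * ((w (n + 1) δ : ℂ) - w n δ)) (g := fun _ => (0:ℂ))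
      (bound := bound) hbound_sum ?_ ?_
    · simpa using h
    · intro n
      have : Tendsto (fun δ => Rt (n + 1) * ((w (n + 1) δ : ℂ) - w n δ)) (𝓝[>] 0)
          (𝓝 (Rt (n + 1) * (1 - 1))) :=
        tendsto_const_nhds.mul ((hw_tendsto (n + 1)).sub (hw_tendsto n))
      simpa using this
    · filter_upwards [hmem] with δ hδ n using hD_le n hδ.1
  have hmain : Tendsto (fun δ => L * (w 0 δ : ℂ) + ∑' n, Rt (n + 1) * ((w (n + 1) δ : ℂ) - w n δ))
      (𝓝[>] 0) (𝓝 (L * 1 + 0)) :=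
    (tendsto_const_nhds.mul (hw_tendsto 0)).add hD_tendsto
  rw [mul_one, add_zero] at hmain
  refine hmain.congr' ?_
  filter_upwards [hmem] with δ hδ
  exact (hA_eq hδ.1 hδ.2).symm

omit [NeZero q] in
/-- **`A'(δ) = Σ χ(n) K'(δn)`** for `δ > 0` (term-wise differentiation, locally uniformly dominated by
`6/(1 + δ²n²/4)`). [cite: Ramare2001LOneApproximateFormulae, §IV p. 256 (proof of Thm. 1)] -/
theorem hasDerivAt_fejerLSeries {δ : ℝ} (hδ : 0 < δ) :
    HasDerivAt (fun y : ℝ => ∑' n : ℕ, χ ((n + 1 : ℕ) : ZMod q) *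
        ((Real.sinc (π * (y * (n + 1))) ^ 2 / (n + 1) : ℝ) : ℂ))
      (∑' n : ℕ, χ ((n + 1 : ℕ) : ZMod q) *
        ((-(4 * π * ∫ t in (0:ℝ)..1, (1 - t) * t * Real.sin (2 * π * (δ * (n + 1)) * t)) : ℝ) : ℂ)) δ := by
  set W : ℝ → ℝ := fun x => -(4 * π * ∫ t in (0:ℝ)..1, (1 - t) * t * Real.sin (2 * π * x * t)) with hW
  set term : ℕ → ℝ → ℂ := fun n y => χ ((n + 1 : ℕ) : ZMod q) *
    ((Real.sinc (π * (y * (n + 1))) ^ 2 / (n + 1) : ℝ) : ℂ) with hterm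
  have hderiv : ∀ (n : ℕ) (y : ℝ),
      HasDerivAt (term n) (χ ((n + 1 : ℕ) : ZMod q) * ((W (y * (n + 1))) : ℂ)) y := by
    intro n y
    have hn : (0 : ℝ) < n + 1 := by positivity
    have h1 := hasDerivAt_sinc_sq (y * (n + 1))
    have h2 : HasDerivAt (fun y : ℝ => y * (n + 1)) ((n : ℝ) + 1) y := by
      simpa using (hasDerivAt_id y).mul_const ((n : ℝ) + 1)
    have h3 := h1.comp y h2
    have h4 := ((h3.div_const ((n : ℝ) + 1)).ofReal_comp).const_mul (χ ((n + 1 : ℕ) : ZMod q))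
    refine (h4.congr_of_eventuallyEq (Eventually.of_forall fun z => by
      simp [hterm, Function.comp])).congr_deriv ?_
    rw [mul_div_cancel_right₀ _ hn.ne', hW]
  have hsumm := summable_fejerLSeries χ hδ
  have hyI : δ ∈ Set.Ioi (δ / 2) := by simp only [Set.mem_Ioi]; linarith
  have hF := hasDerivAt_tsum_of_isPreconnected (t := Ioi (δ / 2)) (y₀ := δ) (y := δ)
    (u := fun n : ℕ => 6 / (1 + (δ / 2) ^ 2 * ((n : ℝ) + 1) ^ 2)) ?_
    isOpen_Ioi isPreconnected_Ioi (fun n z _ => hderiv n z) ?_ hyI hsumm hyI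
  · refine (hF.congr_of_eventuallyEq (Eventually.of_forall fun z => by simp [hterm])).congr_deriv ?_
    refine tsum_congr fun n => ?_
    simp only [hW]
  · have : Summable fun n : ℕ => 6 / (δ / 2) ^ 2 * (1 / ((n : ℝ) + 1) ^ 2) := by
      have := (summable_nat_add_iff 1 |>.2 (Real.summable_one_div_nat_pow.2 one_lt_two)).mul_left
        (6 / (δ / 2) ^ 2)
      refine this.congr fun n => ?_
      push_cast; ring_nf
    refine Summable.of_nonneg_of_le (fun n => by positivity) (fun n => ?_) this
    have hpos : 0 < (δ / 2) ^ 2 * ((n : ℝ) + 1) ^ 2 := by positivity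
    have heq : 6 / (δ / 2) ^ 2 * (1 / ((n : ℝ) + 1) ^ 2)
        = 6 / ((δ / 2) ^ 2 * ((n : ℝ) + 1) ^ 2) := by
      rw [mul_one_div, div_div]
    rw [heq]
    exact div_le_div_of_nonneg_left (by positivity) hpos (by linarith)
  · intro n z hz
    rw [norm_mul, Complex.norm_real, Real.norm_eq_abs, hW]
    refine (mul_le_of_le_one_left (abs_nonneg _) (χ.norm_le_one _)).trans ?_
    simp only [abs_neg]
    refine (abs_sinc_sq_deriv_le_div_one_add_sq _).trans ?_
    apply div_le_div_of_nonneg_left (by positivity) (by positivity)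
    have hz' : δ / 2 < z := hz
    have : (δ / 2) ^ 2 * ((n : ℝ) + 1) ^ 2 ≤ (z * (n + 1)) ^ 2 := by
      rw [mul_pow]; gcongr
    linarith


end Smoothed

/-! ## Poisson summation for the derivative, and the dual polynomial `P(y) = (1 − min(y,1))²` -/

section Dual

variable {Gc : ℝ → ℂ} {P : ℝ → ℝ}

/-- `G(y) = 2πi·y(1 − min(y,1))` for `y ≥ 0`. [cite: Ramare2001LOneApproximateFormulae, §II p. 249] -/
theorem fejerDerivG_eq_of_nonneg
    (hG : Gc = fun u => if |u| ≤ 1 then (((2 * π * u * (1 - |u|)) : ℝ) : ℂ) * Complex.I else 0)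
    {y : ℝ} (hy : 0 ≤ y) : Gc y = ((2 * π * y * (1 - min y 1) : ℝ) : ℂ) * Complex.I := by
  rcases le_or_gt y 1 with h | h
  · rw [fejerDerivG_eq_of_mem hG ⟨hy, h⟩, min_eq_left h]
  · rw [fejerDerivG_eq_zero hG (by rw [abs_of_nonneg hy]; exact h.le), min_eq_right h.le]; simp

/-- **Twisted Poisson summation for `Σ χ(n)K'(δn)`** (odd primitive `χ`, `0 < δ < 1`):
`Σ_{n≥1} χ(n) K'(δn) = (δq)⁻¹ τ(χ) Σ_{1 ≤ m ≤ q} χ̄(m) G(m/(δq))`, `G(u) = 2πi·u(1−|u|)₊`.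
[cite: Ramare2001LOneApproximateFormulae, Lemma 11 p. 256] -/
theorem tsum_char_mul_fejerDeriv_eq (hχ : χ.IsPrimitive) (hχ1 : χ ≠ 1) (hodd : χ.Odd)
    (hG : Gc = fun u => if |u| ≤ 1 then (((2 * π * u * (1 - |u|)) : ℝ) : ℂ) * Complex.I else 0)
    {δ : ℝ} (hδ : 0 < δ) (hδ1 : δ < 1) :
    ∑' n : ℕ, χ ((n + 1 : ℕ) : ZMod q) *
        ((-(4 * π * ∫ t in (0:ℝ)..1, (1 - t) * t * Real.sin (2 * π * (δ * (n + 1)) * t)) : ℝ) : ℂ)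
      = (((δ * q)⁻¹ : ℝ) : ℂ) * gaussSum χ (ZMod.stdAddChar (N := q)) *
        ∑ m ∈ Finset.range q, χ⁻¹ ((m + 1 : ℕ) : ZMod q) * Gc ((m + 1) / (δ * q)) := by
  set W : ℝ → ℝ := fun x => -(4 * π * ∫ t in (0:ℝ)..1, (1 - t) * t * Real.sin (2 * π * x * t))
    with hW
  have hq1 : q ≠ 1 := by rintro rfl; exact hχ1 χ.level_one
  have hqne : q ≠ 0 := NeZero.ne q
  haveI : Fact (1 < q) := ⟨by omega⟩
  have hq0 : (0:ℝ) < q := by positivity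
  have hneg : ∀ x : ZMod q, χ (-x) = -χ x := fun x => by
    rw [neg_eq_neg_one_mul, map_mul, show χ (-1) = -1 from hodd, neg_one_mul]
  have hneg' : ∀ x : ZMod q, χ⁻¹ (-x) = -χ⁻¹ x := fun x => by
    rw [MulChar.inv_apply_eq_inv', MulChar.inv_apply_eq_inv', hneg, inv_neg]
  have hGc : Continuous Gc := continuous_fejerDerivG hG
  have hG0 : ∀ u : ℝ, 1 ≤ |u| → Gc u = 0 := fun u hu => fejerDerivG_eq_zero hG hu
  have hV : ∀ y : ℝ, (W y : ℂ) = ∫ u : ℝ, Gc u * Complex.exp (2 * π * Complex.I * u * y) :=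
    fun y => by rw [integral_fejerDerivG_mul_cexp hG y]
  have hdec : ∀ y : ℝ, ‖(W y : ℂ)‖ ≤ 6 / (1 + y ^ 2) := fun y => by
    rw [Complex.norm_real, Real.norm_eq_abs]; simp only [hW, abs_neg]
    exact abs_sinc_sq_deriv_le_div_one_add_sq y
  have hP := tsum_char_mul_eq_of_bandlimited hχ hGc hG0 hV hdec hδ
  have hWneg : ∀ x, W (-x) = -W x := fun x => by simp only [hW]; rw [sinc_sq_deriv_neg]
  have hL : ∑' n : ℤ, χ (n : ZMod q) * (W (δ * n) : ℂ)
      = 2 * ∑' n : ℕ, χ ((n + 1 : ℕ) : ZMod q) * (W (δ * (n + 1)) : ℂ) := by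
    rw [tsum_int_eq_two_mul_tsum_nat (f := fun n : ℤ => χ (n : ZMod q) * (W (δ * n) : ℂ)) ?_ ?_ ?_]
    · congr 1
      refine tsum_congr fun n => ?_
      push_cast; ring_nf
    · exact summable_int_of_norm_le_div hδ fun n => by
        rw [norm_mul]
        exact (mul_le_of_le_one_left (norm_nonneg _) (χ.norm_le_one _)).trans (hdec _)
    · intro n; simp only [Int.cast_neg, hneg, mul_neg, hWneg, Complex.ofReal_neg, neg_mul, neg_neg]
    · simp [MulChar.map_zero]
  have hR : ∑' m : ℤ, χ⁻¹ (m : ZMod q) * Gc (m / (δ * q))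
      = 2 * ∑ m ∈ Finset.range q, χ⁻¹ ((m + 1 : ℕ) : ZMod q) * Gc ((m + 1) / (δ * q)) := by
    rw [tsum_int_eq_two_mul_tsum_nat (f := fun m : ℤ => χ⁻¹ (m : ZMod q) * Gc (m / (δ * q)))
      ?_ ?_ ?_]
    · congr 1
      rw [tsum_eq_sum (s := Finset.range q) ?_]
      · refine Finset.sum_congr rfl fun m _ => ?_
        push_cast; ring_nf
      · intro m hm
        simp only [Finset.mem_range, not_lt] at hm
        have hm' : (q:ℝ) ≤ m := by exact_mod_cast hm
        rw [hG0 _ ?_, mul_zero]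
        push_cast
        rw [abs_of_nonneg (by positivity), le_div_iff₀ (by positivity), one_mul]
        nlinarith
    · exact summable_samples_of_bandlimited hG0 (fun m => χ⁻¹ (m : ZMod q)) (by positivity)
    · intro m
      simp only [Int.cast_neg, hneg', neg_div, fejerDerivG_neg hG, neg_mul, mul_neg, neg_neg]
    · simp [MulChar.map_zero]
  rw [hL, hR] at hP
  have h3 : ∑' n : ℕ, χ ((n + 1 : ℕ) : ZMod q) *
        ((-(4 * π * ∫ t in (0:ℝ)..1, (1 - t) * t * Real.sin (2 * π * (δ * (n + 1)) * t)) : ℝ) : ℂ)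
      = ∑' n : ℕ, χ ((n + 1 : ℕ) : ZMod q) * (W (δ * (n + 1)) : ℂ) := by simp only [hW]
  rw [h3]
  calc ∑' n : ℕ, χ ((n + 1 : ℕ) : ZMod q) * (W (δ * (n + 1)) : ℂ)
      = (1 / 2 : ℂ) * (2 * ∑' n : ℕ, χ ((n + 1 : ℕ) : ZMod q) * (W (δ * (n + 1)) : ℂ)) := by ring
    _ = _ := by rw [hP]; ring

/-- `P(y) = 0` for `y ≥ 1`. [cite: Ramare2001LOneApproximateFormulae, Prop. 2 p. 247] -/
theorem fejerDualP_eq_zero (hP : P = fun y => ∫ u in y..1, 2 * (1 - min u 1)) {y : ℝ} (hy : 1 ≤ y) :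
    P y = 0 := by
  rw [hP]; simp only
  rw [intervalIntegral.integral_congr (g := fun _ => (0:ℝ)) ?_]
  · simp
  · intro u hu
    rw [uIcc_of_ge hy] at hu
    simp only
    rw [min_eq_right hu.1]; ring

/-- `P(y) = (1 − y)²` for `y ≤ 1`. [cite: Ramare2001LOneApproximateFormulae, Prop. 2 p. 247] -/
theorem fejerDualP_eq (hP : P = fun y => ∫ u in y..1, 2 * (1 - min u 1)) {y : ℝ} (hy : y ≤ 1) :
    P y = (1 - y) ^ 2 := by
  rw [hP]; simp only
  rw [intervalIntegral.integral_congr (g := fun u => 2 - 2 * u) ?_]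
  · have hd : ∀ u ∈ uIcc y 1, HasDerivAt (fun u : ℝ => 2 * u - u ^ 2) (2 - 2 * u) u := by
      intro u _
      have := ((hasDerivAt_id u).const_mul 2).sub (hasDerivAt_pow 2 u)
      refine this.congr_deriv ?_
      simp
    rw [intervalIntegral.integral_eq_sub_of_hasDerivAt hd
      ((by fun_prop : Continuous fun u : ℝ => 2 - 2 * u).intervalIntegrable _ _)]
    ring
  · intro u hu
    rw [uIcc_of_le hy] at hu
    simp only
    rw [min_eq_left hu.2]; ring

/-- `P ≥ 0`. [cite: Ramare2001LOneApproximateFormulae, Prop. 2 p. 247] -/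
theorem fejerDualP_nonneg (hP : P = fun y => ∫ u in y..1, 2 * (1 - min u 1)) (y : ℝ) : 0 ≤ P y := by
  rcases le_or_gt y 1 with h | h
  · rw [fejerDualP_eq hP h]; positivity
  · rw [fejerDualP_eq_zero hP h.le]

/-- `P'(y) = −2(1 − min(y,1))` (so `P` is `C¹` across `y = 1`). [cite: Ramare2001LOneApproximateFormulae, Prop. 2 p. 247] -/
theorem hasDerivAt_fejerDualP (hP : P = fun y => ∫ u in y..1, 2 * (1 - min u 1)) (y : ℝ) :
    HasDerivAt P (-(2 * (1 - min y 1))) y := by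
  have hc : Continuous fun u : ℝ => 2 * (1 - min u 1) := by fun_prop
  rw [hP]
  exact intervalIntegral.integral_hasDerivAt_left (hc.intervalIntegrable _ _)
    (hc.stronglyMeasurableAtFilter _ _) hc.continuousAt

/-- **Derivative of the dual sum**:
`d/dδ Σ_m c_m P((m+1)/(δκ)) = Σ_m c_m · 2(1 − min(y_m,1))·y_m/δ`, `y_m = (m+1)/(δκ)`.
[cite: Ramare2001LOneApproximateFormulae, Prop. 2 p. 247] -/
theorem hasDerivAt_fejerDualSum (hP : P = fun y => ∫ u in y..1, 2 * (1 - min u 1))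
    (c : ℕ → ℂ) (M : ℕ) {κ : ℝ} (hκ : 0 < κ) {δ : ℝ} (hδ : 0 < δ) :
    HasDerivAt (fun y : ℝ => ∑ m ∈ Finset.range M, c m * (P ((m + 1) / (y * κ)) : ℂ))
      (∑ m ∈ Finset.range M, c m *
        ((2 * (1 - min ((m + 1) / (δ * κ)) 1) * ((m + 1) / (δ * κ)) / δ : ℝ) : ℂ)) δ := by
  refine HasDerivAt.fun_sum fun m _ => ?_
  have hm : (0:ℝ) < (m:ℝ) + 1 := by positivity
  have hJ' := hasDerivAt_fejerDualP hP (((m:ℝ) + 1) / κ * δ⁻¹)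
  have hinner : HasDerivAt (fun y : ℝ => ((m:ℝ) + 1) / κ * y⁻¹) (((m:ℝ) + 1) / κ * (-(δ ^ 2)⁻¹)) δ :=
    (hasDerivAt_inv hδ.ne').const_mul _
  have hcomp := ((hJ'.comp δ hinner).ofReal_comp).const_mul (c m)
  have hfun : (fun y : ℝ => c m * (P ((m + 1) / (y * κ)) : ℂ))
      = fun y => c m * ((P ∘ fun y : ℝ => ((m:ℝ) + 1) / κ * y⁻¹) y : ℂ) := by
    funext y
    simp only [Function.comp]
    rw [show ((m:ℝ) + 1) / (y * κ) = ((m:ℝ) + 1) / κ * y⁻¹ by ring]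
  rw [hfun]
  refine hcomp.congr_deriv ?_
  have harg : ((m:ℝ) + 1) / κ * δ⁻¹ = ((m:ℝ) + 1) / (δ * κ) := by field_simp
  rw [harg]
  congr 1
  rw [Complex.ofReal_inj]
  have hδ0 : δ ≠ 0 := hδ.ne'
  have hκ0 : κ ≠ 0 := hκ.ne'
  field_simp

end Dual

/-! ## Proposition 2 (odd characters, `F₄ = 1 − K`) -/

section Formula

variable {P : ℝ → ℝ}

/-- **Ramaré's Proposition 2 for odd characters** (`F₄ = 1 − K`, honest sign): for `χ` odd primitive
mod `q`, `χ ≠ 1`, and `0 < δ < 1`,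
`L(1,χ) = Σ_{n≥1} χ(n)K(δn)/n − (iπτ(χ)/q) Σ_{1 ≤ m ≤ q} χ̄(m) (1 − m/(δq))₊²`
(the terms with `m > δq` vanish).  Proof: the two sides have equal `δ`-derivatives (term-wise
differentiation + twisted Poisson summation), the dual sum vanishes for `δ < 1/q`, and the smoothed sum
tends to `L(1,χ)` as `δ → 0⁺`.  [cite: Ramare2001LOneApproximateFormulae, Prop. 2 p. 247] -/
theorem LFunction_one_eq_fejer_add_dual (hχ : χ.IsPrimitive) (hχ1 : χ ≠ 1) (hodd : χ.Odd)
    (hP : P = fun y => ∫ u in y..1, 2 * (1 - min u 1)) {δ : ℝ} (hδ : 0 < δ) (hδ1 : δ < 1) :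
    χ.LFunction 1 = (∑' n : ℕ, χ ((n + 1 : ℕ) : ZMod q) *
        ((Real.sinc (π * (δ * (n + 1))) ^ 2 / (n + 1) : ℝ) : ℂ))
      - (π * Complex.I * gaussSum χ (ZMod.stdAddChar (N := q)) / q) *
        ∑ m ∈ Finset.range q, χ⁻¹ ((m + 1 : ℕ) : ZMod q) * (P ((m + 1) / (δ * q)) : ℂ) := by
  have hq1 : q ≠ 1 := by rintro rfl; exact hχ1 χ.level_one
  have hqne : q ≠ 0 := NeZero.ne q
  have hq0 : (0:ℝ) < q := by positivity
  set Gc : ℝ → ℂ := fun u => if |u| ≤ 1 then (((2 * π * u * (1 - |u|)) : ℝ) : ℂ) * Complex.I else 0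
    with hG
  set W : ℝ → ℝ := fun x => -(4 * π * ∫ t in (0:ℝ)..1, (1 - t) * t * Real.sin (2 * π * x * t))
    with hW
  set A : ℝ → ℂ := fun y => ∑' n : ℕ, χ ((n + 1 : ℕ) : ZMod q) *
    ((Real.sinc (π * (y * (n + 1))) ^ 2 / (n + 1) : ℝ) : ℂ) with hA
  set T : ℝ → ℂ := fun y => -(π * Complex.I * gaussSum χ (ZMod.stdAddChar (N := q)) / q) *
    ∑ m ∈ Finset.range q, χ⁻¹ ((m + 1 : ℕ) : ZMod q) * (P ((m + 1) / (y * q)) : ℂ) with hT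
  set S : ℝ → ℂ := fun y => ∑' n : ℕ, χ ((n + 1 : ℕ) : ZMod q) * (W (y * (n + 1)) : ℂ) with hS
  have hAd : ∀ y : ℝ, 0 < y → HasDerivAt A (S y) y := fun y hy => by
    have := hasDerivAt_fejerLSeries χ hy
    simp only [hS, hW]
    exact this
  have hTd : ∀ y : ℝ, 0 < y → y < 1 → HasDerivAt T (-S y) y := by
    intro y hy hy1
    have h1 := (hasDerivAt_fejerDualSum hP (fun m => χ⁻¹ ((m + 1 : ℕ) : ZMod q)) q hq0 hy).const_mul
      (-(π * Complex.I * gaussSum χ (ZMod.stdAddChar (N := q)) / q))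
    refine h1.congr_deriv ?_
    simp only [hS, hW]
    rw [tsum_char_mul_fejerDeriv_eq χ hχ hχ1 hodd hG hy hy1, Finset.mul_sum, Finset.mul_sum,
      ← Finset.sum_neg_distrib]
    refine Finset.sum_congr rfl fun m _ => ?_
    rw [fejerDerivG_eq_of_nonneg hG (by positivity : (0:ℝ) ≤ ((m:ℝ) + 1) / (y * q))]
    have hy0 : (y : ℂ) ≠ 0 := Complex.ofReal_ne_zero.2 hy.ne'
    have hq0' : (q : ℂ) ≠ 0 := Nat.cast_ne_zero.2 hqne
    push_cast
    field_simp
  have hE : ∀ y : ℝ, 0 < y → y < 1 → HasDerivAt (fun z => A z + T z) 0 y := fun y hy hy1 => by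
    have := (hAd y hy).add (hTd y hy hy1)
    rw [add_neg_cancel] at this
    exact this
  have hconst : ∀ y y' : ℝ, 0 < y → y < 1 → 0 < y' → y' ≤ y → A y' + T y' = A y + T y := by
    intro y y' hy hy1 hy' hyy'
    have h := constant_of_has_deriv_right_zero (f := fun z => A z + T z) (a := y') (b := y)
      (fun z hz => (hE z (by linarith [hz.1]) (by linarith [hz.2])).continuousAt.continuousWithinAt)
      (fun z hz => (hE z (by linarith [hz.1]) (by linarith [hz.2])).hasDerivWithinAt) y
      ⟨hyy', le_rfl⟩
    exact h.symm
  have hT0 : ∀ y' : ℝ, 0 < y' → y' < 1 / q → T y' = 0 := by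
    intro y' hy' hyq
    have hyq' : y' * q < 1 := by rwa [lt_div_iff₀ hq0] at hyq
    simp only [hT]
    rw [Finset.sum_eq_zero fun m _ => ?_, mul_zero]
    rw [fejerDualP_eq_zero hP ?_, Complex.ofReal_zero, mul_zero]
    rw [le_div_iff₀ (by positivity), one_mul]
    have : (0:ℝ) ≤ m := Nat.cast_nonneg m
    linarith
  have hlim : Tendsto A (𝓝[>] 0) (𝓝 (χ.LFunction 1)) := tendsto_fejerLSeries χ hχ1
  have hAconst : ∀ᶠ y' in 𝓝[>] (0:ℝ), A y' = A δ + T δ := by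
    have hm : Ioo (0:ℝ) (min δ (1 / q)) ∈ 𝓝[>] (0:ℝ) := Ioo_mem_nhdsGT (lt_min hδ (by positivity))
    filter_upwards [hm] with y' hy'
    have h1 := hconst δ y' hδ hδ1 hy'.1 (le_trans hy'.2.le (min_le_left _ _))
    rw [hT0 y' hy'.1 (lt_of_lt_of_le hy'.2 (min_le_right _ _)), add_zero] at h1
    exact h1
  have h2 : Tendsto A (𝓝[>] 0) (𝓝 (A δ + T δ)) :=
    tendsto_const_nhds.congr' (hAconst.mono fun y h => h.symm)
  have h3 := tendsto_nhds_unique hlim h2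
  rw [h3]
  simp only [hT]
  ring

end Formula

end Literature.NumberTheory.LFunctions.Ramare2001
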